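import Mathlib
import HarnessLib

/-!
# `stub_covSlicing` of line `SketchIdeator1` (crux `TetrahedronHarrisGap`, stmt-CriticalPhenomena-7799):
# covariance slicing for `[0,1]`-valued random variables with positively correlated level sets

Registered stub `stub_covSlicing` of the lead's skeleton
`Cruxes/TetrahedronHarrisGap/Lines/SketchIdeator1.lean` (card `corner-ball-total-covariance`).
Pure measure theory; no percolation is involved.

Statement. Let `μ` be a probability measure and `f g : Ω → [0,1]` measurable, such that all level sets
`{s < f}`, `{t < g}` are pairwise positively correlated. If on a window `s, t ∈ [u,v]`, `0 ≤ u`, `v ≤ 1`,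
the level-set covariance is at least `δ P(s < f) P(t < g)`, then
`δ (∫_{[u,v]} P(s < f) ds) (∫_{[u,v]} P(t < g) dt) ≤ E[f g] - E[f] E[g]`.

Proof. The layer-cake identity `x = |{s ∈ [0,1] : s < x}|` for `x ∈ [0,1]` and ONE Fubini exchange on
`Ω × [0,1]` give the slicing identity `∫ f φ dμ = ∫_{s∈[0,1]} ∫ 1{s<f} φ dμ ds` for a bounded measurable
weight `φ` (`integral_mul_eq_integral_integral_indicator`). Applied with `φ = 1`, `φ = g` and
`φ = 1{s<f}` it yields `E f = ∫ P(s<f) ds`, `E g = ∫ P(t<g) dt`, `E[fg] = ∫∫ P(s<f, t<g) dt ds`, so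
`E[fg] - E f E g = ∫_{s∈[0,1]} ∫_{t∈[0,1]} (P(s<f,t<g) - P(s<f)P(t<g)) dt ds`. The integrand is everywhere
nonnegative and at least `δ 1_{[u,v]}(s) 1_{[u,v]}(t) P(s<f) P(t<g)`, whose iterated integral is the left-hand
side (`windowed_sliced_covariance_lower_bound`). All level functions are antitone, hence integrable on
compact intervals (`AntitoneOn.integrableOn_isCompact`); no measurability argument beyond that is needed.
-/

noncomputable section

namespace Summit.CriticalPhenomena.PercolationContinuityZ3.Theorems.TetrahedronHarrisGap

open MeasureTheory Set

/-- Layer cake on `[0,1]`: for `x ∈ [0,1]`, the Lebesgue measure of `{s ∈ [0,1] | s < x}` is `x`. -/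
theorem volume_restrict_unitIcc_real_Iio {x : ℝ} (hx : x ∈ Icc (0 : ℝ) 1) :
    (volume.restrict (Icc (0 : ℝ) 1)).real (Iio x) = x := by
  rw [measureReal_restrict_apply measurableSet_Iio]
  have h : Iio x ∩ Icc (0 : ℝ) 1 = Ico 0 x := by
    ext s
    simp only [mem_inter_iff, mem_Iio, mem_Icc, mem_Ico]
    constructor
    · rintro ⟨h1, h2, -⟩
      exact ⟨h2, h1⟩
    · rintro ⟨h1, h2⟩
      exact ⟨h2, h1, h2.le.trans hx.2⟩
  rw [h, Real.volume_real_Ico_of_le hx.1, sub_zero]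

/-- **Slicing identity** (layer cake + Fubini). For a finite measure `μ`, a measurable `f : Ω → [0,1]`
and a bounded measurable weight `φ`, `∫ f φ dμ = ∫_{s ∈ [0,1]} (∫ 1{s < f} φ dμ) ds`. -/
theorem integral_mul_eq_integral_integral_indicator {Ω : Type*} [MeasurableSpace Ω] (μ : Measure Ω)
    [IsFiniteMeasure μ] {f φ : Ω → ℝ} (hf : Measurable f) (hφ : Measurable φ)
    (hf01 : ∀ ω, f ω ∈ Icc (0 : ℝ) 1) {C : ℝ} (hφC : ∀ ω, ‖φ ω‖ ≤ C) :
    ∫ ω, f ω * φ ω ∂μ = ∫ s in Icc (0 : ℝ) 1, ∫ ω, {ω | s < f ω}.indicator φ ω ∂μ := by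
  -- the joint integrand `F ω s = 1{s < f ω} φ ω` on `Ω × [0,1]`
  have hF_eq : (Function.uncurry fun (ω : Ω) (s : ℝ) => {ω' | s < f ω'}.indicator φ ω) =
      {q : Ω × ℝ | q.2 < f q.1}.indicator fun q => φ q.1 := by
    ext q
    simp only [Function.uncurry, indicator_apply, mem_setOf_eq]
  have hF_int : Integrable (Function.uncurry fun (ω : Ω) (s : ℝ) => {ω' | s < f ω'}.indicator φ ω)
      (μ.prod (volume.restrict (Icc (0 : ℝ) 1))) := by
    rw [hF_eq]
    refine Integrable.of_bound ?_ C (ae_of_all _ fun q => ?_)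
    · exact ((hφ.comp measurable_fst).indicator
        (measurableSet_lt measurable_snd (hf.comp measurable_fst))).aestronglyMeasurable
    · exact (norm_indicator_le_norm_self _ _).trans (hφC q.1)
  -- layer cake, pointwise in `ω`
  have key : (fun ω => f ω * φ ω) =
      fun ω => ∫ s in Icc (0 : ℝ) 1, {ω' | s < f ω'}.indicator φ ω := by
    funext ω
    have hFω : (fun s : ℝ => {ω' | s < f ω'}.indicator φ ω) = (Iio (f ω)).indicator fun _ => φ ω := by
      funext s
      simp only [indicator_apply, mem_setOf_eq, mem_Iio]
    rw [hFω, integral_indicator_const (φ ω) measurableSet_Iio, volume_restrict_unitIcc_real_Iio (hf01 ω),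
      smul_eq_mul]
  rw [key]
  exact integral_integral_swap hF_int

/-- **Windowed lower bound for a sliced covariance** (real-variable core of `stub_covSlicing`).
If `a, b, c(s, ·), Φ` are antitone, `Φ s = ∫_{t∈[0,1]} c(s,t) dt`, `a(s) b(t) ≤ c(s,t)` everywhere and
`δ a(s) b(t) ≤ c(s,t) - a(s) b(t)` on the window `[u,v]² ⊆ [0,1]²`, then
`δ (∫_{[u,v]} a)(∫_{[u,v]} b) ≤ ∫_{[0,1]} Φ - (∫_{[0,1]} a)(∫_{[0,1]} b)`. -/
theorem windowed_sliced_covariance_lower_bound {a b Φ : ℝ → ℝ} {c : ℝ → ℝ → ℝ} {δ u v : ℝ}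
    (hu : 0 ≤ u) (hv : v ≤ 1) (ha : Antitone a) (hb : Antitone b) (hc : ∀ s, Antitone (c s))
    (hΦ : Antitone Φ) (hΦc : ∀ s, Φ s = ∫ t in Icc (0 : ℝ) 1, c s t)
    (hpos : ∀ s t, a s * b t ≤ c s t)
    (hgap : ∀ s ∈ Icc u v, ∀ t ∈ Icc u v, δ * (a s * b t) ≤ c s t - a s * b t) :
    δ * ((∫ s in Icc u v, a s) * (∫ t in Icc u v, b t)) ≤
      (∫ s in Icc (0 : ℝ) 1, Φ s) - (∫ s in Icc (0 : ℝ) 1, a s) * (∫ t in Icc (0 : ℝ) 1, b t) := by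
  have hWI : Icc u v ⊆ Icc (0 : ℝ) 1 := Icc_subset_Icc hu hv
  -- integrability on `[0,1]` of the (antitone) level functions
  have hai : Integrable a (volume.restrict (Icc (0 : ℝ) 1)) :=
    (ha.antitoneOn _).integrableOn_isCompact isCompact_Icc
  have hbi : Integrable b (volume.restrict (Icc (0 : ℝ) 1)) :=
    (hb.antitoneOn _).integrableOn_isCompact isCompact_Icc
  have hci : ∀ s, Integrable (c s) (volume.restrict (Icc (0 : ℝ) 1)) := fun s =>
    ((hc s).antitoneOn _).integrableOn_isCompact isCompact_Icc
  have hΦi : Integrable Φ (volume.restrict (Icc (0 : ℝ) 1)) :=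
    (hΦ.antitoneOn _).integrableOn_isCompact isCompact_Icc
  -- the window integrals as integrals over `[0,1]` of indicators
  have hwa : ∫ s in Icc u v, a s = ∫ s in Icc (0 : ℝ) 1, (Icc u v).indicator a s := by
    rw [setIntegral_indicator measurableSet_Icc, inter_eq_right.mpr hWI]
  have hwb : ∫ t in Icc u v, b t = ∫ t in Icc (0 : ℝ) 1, (Icc u v).indicator b t := by
    rw [setIntegral_indicator measurableSet_Icc, inter_eq_right.mpr hWI]
  -- pointwise (in `s`) lower bound for the inner integral
  have hpt : ∀ s, δ * ((Icc u v).indicator a s * ∫ t in Icc (0 : ℝ) 1, (Icc u v).indicator b t) ≤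
      Φ s - a s * ∫ t in Icc (0 : ℝ) 1, b t := by
    intro s
    have h1 : Φ s - a s * ∫ t in Icc (0 : ℝ) 1, b t = ∫ t in Icc (0 : ℝ) 1, (c s t - a s * b t) := by
      rw [hΦc s, ← integral_const_mul, ← integral_sub (hci s) (hbi.const_mul (a s))]
    have h2 : δ * ((Icc u v).indicator a s * ∫ t in Icc (0 : ℝ) 1, (Icc u v).indicator b t) =
        ∫ t in Icc (0 : ℝ) 1, δ * ((Icc u v).indicator a s * (Icc u v).indicator b t) := by
      rw [← integral_const_mul, ← integral_const_mul]
    rw [h1, h2]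
    refine integral_mono (((hbi.indicator measurableSet_Icc).const_mul _).const_mul δ)
      ((hci s).sub (hbi.const_mul (a s))) fun t => ?_
    show δ * ((Icc u v).indicator a s * (Icc u v).indicator b t) ≤ c s t - a s * b t
    by_cases hs : s ∈ Icc u v
    · by_cases ht : t ∈ Icc u v
      · rw [indicator_of_mem hs, indicator_of_mem ht]
        exact hgap s hs t ht
      · rw [indicator_of_notMem ht, mul_zero, mul_zero]
        exact sub_nonneg.mpr (hpos s t)
    · rw [indicator_of_notMem hs, zero_mul, mul_zero]
      exact sub_nonneg.mpr (hpos s t)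
  -- integrate the pointwise bound over `s ∈ [0,1]`
  calc δ * ((∫ s in Icc u v, a s) * (∫ t in Icc u v, b t))
      = ∫ s in Icc (0 : ℝ) 1,
          δ * ((Icc u v).indicator a s * ∫ t in Icc (0 : ℝ) 1, (Icc u v).indicator b t) := by
        rw [hwa, hwb, ← integral_mul_const, ← integral_const_mul]
    _ ≤ ∫ s in Icc (0 : ℝ) 1, (Φ s - a s * ∫ t in Icc (0 : ℝ) 1, b t) :=
        integral_mono (((hai.indicator measurableSet_Icc).mul_const _).const_mul δ)
          (hΦi.sub (hai.mul_const _)) hpt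
    _ = (∫ s in Icc (0 : ℝ) 1, Φ s) - (∫ s in Icc (0 : ℝ) 1, a s) * (∫ t in Icc (0 : ℝ) 1, b t) := by
        rw [integral_sub hΦi (hai.mul_const _), integral_mul_const]

/-- **Covariance slicing** (named-hypothesis form of `stub_covSlicing`). For a probability measure `μ`
and measurable `f g : Ω → [0,1]` whose level sets `{s < f}`, `{t < g}` are pairwise positively correlated,
if the level-set covariance is at least `δ P(s<f) P(t<g)` for all `s, t` in a window `[u,v]` with
`0 ≤ u`, `v ≤ 1`, then `δ (∫_{[u,v]} P(s<f) ds)(∫_{[u,v]} P(t<g) dt) ≤ E[fg] - E[f] E[g]`. -/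
theorem covariance_ge_windowed_levelSet_covariance {Ω : Type*} [MeasurableSpace Ω] (μ : Measure Ω)
    [IsProbabilityMeasure μ] (f g : Ω → ℝ) (hf : Measurable f) (hg : Measurable g)
    (hf01 : ∀ ω, f ω ∈ Icc (0 : ℝ) 1) (hg01 : ∀ ω, g ω ∈ Icc (0 : ℝ) 1)
    (hpos : ∀ s t : ℝ, μ.real {ω | s < f ω} * μ.real {ω | t < g ω} ≤
      μ.real ({ω | s < f ω} ∩ {ω | t < g ω}))
    (δ u v : ℝ) (hu : 0 ≤ u) (hv : v ≤ 1)
    (hgap : ∀ s ∈ Icc u v, ∀ t ∈ Icc u v,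
      δ * (μ.real {ω | s < f ω} * μ.real {ω | t < g ω}) ≤
        μ.real ({ω | s < f ω} ∩ {ω | t < g ω}) - μ.real {ω | s < f ω} * μ.real {ω | t < g ω}) :
    δ * ((∫ s in Icc u v, μ.real {ω | s < f ω}) * (∫ t in Icc u v, μ.real {ω | t < g ω})) ≤
      ∫ ω, f ω * g ω ∂μ - (∫ ω, f ω ∂μ) * (∫ ω, g ω ∂μ) := by
  have hA : ∀ s : ℝ, MeasurableSet {ω | s < f ω} := fun s => measurableSet_lt measurable_const hf
  have hB : ∀ t : ℝ, MeasurableSet {ω | t < g ω} := fun t => measurableSet_lt measurable_const hg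
  -- antitonicity of the level functions
  have ha : Antitone fun s : ℝ => μ.real {ω | s < f ω} := fun s₁ s₂ h =>
    measureReal_mono fun ω (hω : s₂ < f ω) => lt_of_le_of_lt h hω
  have hb : Antitone fun t : ℝ => μ.real {ω | t < g ω} := fun t₁ t₂ h =>
    measureReal_mono fun ω (hω : t₂ < g ω) => lt_of_le_of_lt h hω
  have hc : ∀ s : ℝ, Antitone fun t : ℝ => μ.real ({ω | s < f ω} ∩ {ω | t < g ω}) :=
    fun s t₁ t₂ h =>
      measureReal_mono (inter_subset_inter_right _ fun ω (hω : t₂ < g ω) => lt_of_le_of_lt h hω)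
  have hci : ∀ s : ℝ, Integrable (fun t : ℝ => μ.real ({ω | s < f ω} ∩ {ω | t < g ω}))
      (volume.restrict (Icc (0 : ℝ) 1)) := fun s =>
    ((hc s).antitoneOn _).integrableOn_isCompact isCompact_Icc
  have hΦ : Antitone fun s : ℝ => ∫ t in Icc (0 : ℝ) 1, μ.real ({ω | s < f ω} ∩ {ω | t < g ω}) := by
    intro s₁ s₂ h
    exact integral_mono (hci s₂) (hci s₁) fun t =>
      measureReal_mono (inter_subset_inter_left _ fun ω (hω : s₂ < f ω) => lt_of_le_of_lt h hω)
  -- bounds on the weights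
  have hg1 : ∀ ω, ‖g ω‖ ≤ 1 := fun ω => by
    rw [Real.norm_of_nonneg (hg01 ω).1]
    exact (hg01 ω).2
  have hone : ∀ ω : Ω, ‖(fun _ : Ω => (1 : ℝ)) ω‖ ≤ 1 := fun ω => by simp
  have hind1 : ∀ (s : ℝ) (ω : Ω), ‖{ω' | s < f ω'}.indicator (fun _ : Ω => (1 : ℝ)) ω‖ ≤ 1 :=
    fun s ω => (norm_indicator_le_norm_self _ _).trans (hone ω)
  -- the three slicing identities
  have h1 : ∫ ω, f ω ∂μ = ∫ s in Icc (0 : ℝ) 1, μ.real {ω | s < f ω} := by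
    have e := integral_mul_eq_integral_integral_indicator μ hf measurable_const hf01 hone
    simp only [mul_one] at e
    rw [e]
    congr 1
    funext s
    rw [integral_indicator_const _ (hA s), smul_eq_mul, mul_one]
  have h2 : ∫ ω, g ω ∂μ = ∫ t in Icc (0 : ℝ) 1, μ.real {ω | t < g ω} := by
    have e := integral_mul_eq_integral_integral_indicator μ hg measurable_const hg01 hone
    simp only [mul_one] at e
    rw [e]
    congr 1
    funext t
    rw [integral_indicator_const _ (hB t), smul_eq_mul, mul_one]
  have h3 : ∫ ω, f ω * g ω ∂μ =
      ∫ s in Icc (0 : ℝ) 1, ∫ t in Icc (0 : ℝ) 1, μ.real ({ω | s < f ω} ∩ {ω | t < g ω}) := by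
    rw [integral_mul_eq_integral_integral_indicator μ hf hg hf01 hg1]
    congr 1
    funext s
    have e1 : ∫ ω, {ω' | s < f ω'}.indicator g ω ∂μ =
        ∫ ω, g ω * {ω' | s < f ω'}.indicator (fun _ : Ω => (1 : ℝ)) ω ∂μ := by
      congr 1
      funext ω
      simp only [indicator_apply, mem_setOf_eq, mul_ite, mul_one, mul_zero]
    rw [e1, integral_mul_eq_integral_integral_indicator μ hg (measurable_const.indicator (hA s)) hg01
      (hind1 s)]
    congr 1
    funext t
    rw [indicator_indicator, integral_indicator_const _ ((hB t).inter (hA s)), smul_eq_mul, mul_one,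
      inter_comm]
  rw [h1, h2, h3]
  exact windowed_sliced_covariance_lower_bound hu hv ha hb hc hΦ (fun s => rfl) hpos hgap

/-- **stub_covSlicing** (covariance slicing for associated `[0,1]`-valued variables; pure measure theory),
the registered stub of line `SketchIdeator1` for crux `TetrahedronHarrisGap`, verbatim (universe-polymorphic
`Ω : Type*`; the skeleton's composition uses its `Ω : Type` instance).
If all level sets of `f` and `g` are pairwise positively correlated, then the covariance of `f` and `g`
dominates `δ (∫_{[u,v]} P(f>s) ds)(∫_{[u,v]} P(g>t) dt)` as soon as the level-set covariance is at least
`δ P(f>s) P(g>t)` for all `s, t ∈ [u,v] ⊆ [0,1]`. -/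
theorem stub_covSlicing :
    ∀ {Ω : Type*} [MeasurableSpace Ω] (μ : Measure Ω) [IsProbabilityMeasure μ] (f g : Ω → ℝ),
      Measurable f → Measurable g → (∀ ω, f ω ∈ Set.Icc (0 : ℝ) 1) → (∀ ω, g ω ∈ Set.Icc (0 : ℝ) 1) →
      (∀ s t : ℝ, μ.real {ω | s < f ω} * μ.real {ω | t < g ω} ≤ μ.real ({ω | s < f ω} ∩ {ω | t < g ω})) →
      ∀ (δ u v : ℝ), 0 ≤ u → v ≤ 1 →
      (∀ s ∈ Set.Icc u v, ∀ t ∈ Set.Icc u v,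
        δ * (μ.real {ω | s < f ω} * μ.real {ω | t < g ω}) ≤
          μ.real ({ω | s < f ω} ∩ {ω | t < g ω}) - μ.real {ω | s < f ω} * μ.real {ω | t < g ω}) →
      δ * ((∫ s in Set.Icc u v, μ.real {ω | s < f ω}) * (∫ t in Set.Icc u v, μ.real {ω | t < g ω})) ≤
        ∫ ω, f ω * g ω ∂μ - (∫ ω, f ω ∂μ) * (∫ ω, g ω ∂μ) :=
  fun μ _ f g hf hg hf01 hg01 hpos δ u v hu hv hgap =>
    covariance_ge_windowed_levelSet_covariance μ f g hf hg hf01 hg01 hpos δ u v hu hv hgap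

end Summit.CriticalPhenomena.PercolationContinuityZ3.Theorems.TetrahedronHarrisGap

end
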